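import Mathlib
import HarnessLib
import Summits.AtomisticToContinuum.FouriersLaw.Theses.JunctionLocality
import Summits.AtomisticToContinuum.FouriersLaw.Theorems.JunctionLocalitySuperadditiveResistanceKuboGauss

/-!
# Kubo–Onsager for the γ-thermostatted pinned chain, VII: terminals and linear combinations of fields

Helper file (`--supports` stmt-AtomisticToContinuum-11748) for stub `stub_kuboOnsager` of the line
`floating-probe-bypass-laplacian` (crux `JunctionLocality.SuperadditiveResistance`). Bookkeeping for the
quadratic form of the Kubo matrix:

* `termWeight s` — the site weights `B_i = Σ_a [s a = i]` of `m` thermostatted TERMINAL sites `s : Fin m → Fin L`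
  (the indicator of the range when `s` is injective); `sum_termWeight_mul`: `Σ_i B_i F_i = Σ_a F (s a)`.
* `comb θ g = Σ_a θ_a g_a` — linear combinations of fields, with `∂`, `X_H`, `S_B`, `C²`, `L²(μ_T)` passing through
  the sum (`partialP_comb`, `liouvilleOp_comb`, `bathOp_comb`, `comb_pair`, `memLp_comb`), and the bilinear
  expansion `integral_comb_mul_comb` of `∫ (Σ_a θ_a g_a)(Σ_b θ_b k_b) ρ`.
References: folklore.
-/

noncomputable section

open MeasureTheory Filter Topology ProbabilityTheory
open scoped ContDiff NNReal ENNReal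
open Literature.MathematicalPhysics.KineticTheory.HeatConduction
open Summit.AtomisticToContinuum.FouriersLaw.Theorems.SuperadditiveResistance.DeviceLiouville

namespace Summit.AtomisticToContinuum.FouriersLaw.Theorems.SuperadditiveResistance.Kubo

section Terminals

variable {L m : ℕ}

/-- Site weights of `m` thermostatted terminal sites `s : Fin m → Fin L`: `B_i = Σ_a [s a = i]`. [folklore] -/
def termWeight (s : Fin m → Fin L) (i : Fin L) : ℝ := ∑ a, if s a = i then 1 else 0

/-- `0 ≤ B_i`. [folklore] -/
theorem termWeight_nonneg (s : Fin m → Fin L) (i : Fin L) : 0 ≤ termWeight s i :=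
  Finset.sum_nonneg fun a _ => by split_ifs <;> norm_num

/-- For injective `s`, `B_{s a} = 1`. [folklore] -/
theorem termWeight_apply (s : Fin m → Fin L) (hs : Function.Injective s) (a : Fin m) : termWeight s (s a) = 1 := by
  unfold termWeight
  rw [Finset.sum_eq_single_of_mem a (Finset.mem_univ _) fun b _ hb => if_neg fun h => hb (hs h)]
  simp

/-- `0 < B_{s a}` (injective `s`). [folklore] -/
theorem termWeight_pos (s : Fin m → Fin L) (hs : Function.Injective s) (a : Fin m) : 0 < termWeight s (s a) := by
  rw [termWeight_apply s hs a]; norm_num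

/-- `Σ_i B_i F_i = Σ_a F (s a)`. [folklore] -/
theorem sum_termWeight_mul (s : Fin m → Fin L) (F : Fin L → ℝ) : ∑ i, termWeight s i * F i = ∑ a, F (s a) := by
  unfold termWeight
  simp only [Finset.sum_mul]
  rw [Finset.sum_comm]
  refine Finset.sum_congr rfl fun a _ => ?_
  simp [Finset.sum_ite_eq]

end Terminals

section Combination

variable {L m : ℕ}

/-- Linear combination of a family of fields: `comb θ g = Σ_a θ_a g_a`. [folklore] -/
def comb (θ : Fin m → ℝ) (g : Fin m → PhaseSpace L → ℝ) (x : PhaseSpace L) : ℝ := ∑ a, θ a * g a x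

/-- Unfolding `comb`. [folklore] -/
theorem comb_apply (θ : Fin m → ℝ) (g : Fin m → PhaseSpace L → ℝ) (x : PhaseSpace L) :
    comb θ g x = ∑ a, θ a * g a x := rfl

/-- `comb` is as smooth as its members. [folklore] -/
theorem contDiff_comb {n : WithTop ℕ∞} (θ : Fin m → ℝ) {g : Fin m → PhaseSpace L → ℝ}
    (hg : ∀ a, ContDiff ℝ n (g a)) : ContDiff ℝ n (comb θ g) := by
  unfold comb
  exact ContDiff.sum fun a _ => contDiff_const.mul (hg a)

/-- `comb` is continuous if its members are. [folklore] -/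
theorem continuous_comb (θ : Fin m → ℝ) {g : Fin m → PhaseSpace L → ℝ} (hg : ∀ a, Continuous (g a)) :
    Continuous (comb θ g) := by
  unfold comb
  exact continuous_finsetSum _ fun a _ => continuous_const.mul (hg a)

/-- `∂_{p_i}` passes through `comb`. [folklore] -/
theorem partialP_comb (θ : Fin m → ℝ) {g : Fin m → PhaseSpace L → ℝ} (hg : ∀ a, Differentiable ℝ (g a))
    (i : Fin L) (x : PhaseSpace L) :
    partialP i (comb θ g) x = ∑ a, θ a * partialP i (g a) x := by
  unfold partialP comb
  have hd : ∀ a, DifferentiableAt ℝ (fun t => g a (x.1, Function.update x.2 i t)) (x.2 i) := fun a =>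
    (differentiable_lineP (hg a) i x) (x.2 i)
  rw [deriv_fun_sum fun a _ => (hd a).const_mul (θ a)]
  refine Finset.sum_congr rfl fun a _ => ?_
  exact deriv_const_mul (θ a) (hd a)

/-- `∂_{q_i}` passes through `comb`. [folklore] -/
theorem partialQ_comb (θ : Fin m → ℝ) {g : Fin m → PhaseSpace L → ℝ} (hg : ∀ a, Differentiable ℝ (g a))
    (i : Fin L) (x : PhaseSpace L) :
    partialQ i (comb θ g) x = ∑ a, θ a * partialQ i (g a) x := by
  unfold partialQ comb
  have hd : ∀ a, DifferentiableAt ℝ (fun t => g a (Function.update x.1 i t, x.2)) (x.1 i) := fun a =>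
    (differentiable_lineQ (hg a) i x) (x.1 i)
  rw [deriv_fun_sum fun a _ => (hd a).const_mul (θ a)]
  refine Finset.sum_congr rfl fun a _ => ?_
  exact deriv_const_mul (θ a) (hd a)

/-- As functions: `∂_{p_i}(comb θ g) = comb θ (∂_{p_i} g)`. [folklore] -/
theorem partialP_comb_eq (θ : Fin m → ℝ) {g : Fin m → PhaseSpace L → ℝ} (hg : ∀ a, Differentiable ℝ (g a))
    (i : Fin L) : partialP i (comb θ g) = comb θ (fun a => partialP i (g a)) := by
  funext x; rw [partialP_comb θ hg]; rfl

/-- `∂²_{p_i}` passes through `comb` (members `C²`). [folklore] -/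
theorem partialP_partialP_comb (θ : Fin m → ℝ) {g : Fin m → PhaseSpace L → ℝ} (hg : ∀ a, ContDiff ℝ 2 (g a))
    (i : Fin L) (x : PhaseSpace L) :
    partialP i (partialP i (comb θ g)) x = ∑ a, θ a * partialP i (partialP i (g a)) x := by
  rw [partialP_comb_eq θ (fun a => (hg a).differentiable two_ne_zero),
    partialP_comb θ (fun a => differentiable_partialP_of_contDiff_two (hg a) i)]

/-- `X_H` passes through `comb`. [folklore] -/
theorem liouvilleOp_comb (P : OscillatorChain) (θ : Fin m → ℝ) {g : Fin m → PhaseSpace L → ℝ}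
    (hg : ∀ a, Differentiable ℝ (g a)) (x : PhaseSpace L) :
    liouvilleOp P L (comb θ g) x = ∑ a, θ a * liouvilleOp P L (g a) x := by
  unfold liouvilleOp
  simp only [partialP_comb θ hg, partialQ_comb θ hg, Finset.mul_sum, ← Finset.sum_sub_distrib]
  rw [Finset.sum_comm]
  refine Finset.sum_congr rfl fun a _ => Finset.sum_congr rfl fun i _ => ?_
  ring

/-- `S_B` passes through `comb` (members `C²`). [folklore] -/
theorem bathOp_comb (B : Fin L → ℝ) (T : ℝ) (θ : Fin m → ℝ) {g : Fin m → PhaseSpace L → ℝ}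
    (hg : ∀ a, ContDiff ℝ 2 (g a)) (x : PhaseSpace L) :
    bathOp L B T (comb θ g) x = ∑ a, θ a * bathOp L B T (g a) x := by
  unfold bathOp
  simp only [partialP_comb θ (fun a => (hg a).differentiable two_ne_zero), partialP_partialP_comb θ hg,
    Finset.mul_sum, ← Finset.sum_sub_distrib]
  rw [Finset.sum_comm]
  refine Finset.sum_congr rfl fun a _ => Finset.sum_congr rfl fun i _ => ?_
  ring

/-- **A linear combination of `σ`-pairs is a `σ`-pair**: `σ X_H (Σθ_a g_a) + c S_B (Σθ_a g_a) = −Σθ_a k_a`. [folklore] -/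
theorem comb_pair (P : OscillatorChain) (B : Fin L → ℝ) (T σ c : ℝ) (θ : Fin m → ℝ)
    {g k : Fin m → PhaseSpace L → ℝ} (hg : ∀ a, ContDiff ℝ 2 (g a))
    (hpde : ∀ a x, σ * liouvilleOp P L (g a) x + c * bathOp L B T (g a) x = -k a x) (x : PhaseSpace L) :
    σ * liouvilleOp P L (comb θ g) x + c * bathOp L B T (comb θ g) x = -comb θ k x := by
  rw [liouvilleOp_comb P θ (fun a => (hg a).differentiable two_ne_zero), bathOp_comb B T θ hg, comb_apply,
    Finset.mul_sum, Finset.mul_sum, ← Finset.sum_add_distrib, ← Finset.sum_neg_distrib]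
  refine Finset.sum_congr rfl fun a _ => ?_
  have := hpde a x
  linear_combination θ a * this

/-- `comb` of `L²` fields is `L²`. [folklore] -/
theorem memLp_comb {μ : Measure (PhaseSpace L)} (θ : Fin m → ℝ) {g : Fin m → PhaseSpace L → ℝ}
    (hg : ∀ a, MemLp (g a) 2 μ) : MemLp (comb θ g) 2 μ := by
  unfold comb
  exact memLp_finsetSum _ fun a _ => (hg a).const_mul (θ a)

/-- `rev` passes through `comb`. [folklore] -/
theorem rev_comb (θ : Fin m → ℝ) (g : Fin m → PhaseSpace L → ℝ) : rev (comb θ g) = comb θ (fun a => rev (g a)) := by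
  funext x; simp [rev, comb]

end Combination

section Bilinear

variable {ω₂ lam β γ : ℝ} {L m : ℕ}

set_option hygiene false in
/-- Local shorthand for the pinned chain of this section. -/
local notation "𝐏" => pinnedChain ω₂ lam β γ

/-- **Bilinear expansion**: for `g_a, k_b ∈ L²(μ_T)`,
`∫ (Σ_a θ_a g_a)(Σ_b η_b k_b) ρ = Σ_a Σ_b θ_a η_b ∫ g_a k_b ρ`. [folklore] -/
theorem integral_comb_mul_comb (hω : 0 < ω₂) (hl : 0 ≤ lam) (hβ : 0 ≤ β) (L : ℕ) {T : ℝ} (hT : 0 < T)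
    (θ η : Fin m → ℝ) {g k : Fin m → PhaseSpace L → ℝ}
    (hg : ∀ a, MemLp (g a) 2 ((𝐏).gibbsMeasure L T)) (hk : ∀ b, MemLp (k b) 2 ((𝐏).gibbsMeasure L T)) :
    ∫ x, comb θ g x * comb η k x * (𝐏).gibbsDensity L T x =
      ∑ a, ∑ b, θ a * η b * ∫ x, g a x * k b x * (𝐏).gibbsDensity L T x := by
  have hI : ∀ a b, Integrable fun x => g a x * k b x * (𝐏).gibbsDensity L T x := fun a b =>
    integrable_mul_mul_gibbsDensity hω hl hβ γ L hT (hg a) (hk b)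
  have hpt : (fun x => comb θ g x * comb η k x * (𝐏).gibbsDensity L T x) =
      fun x => ∑ a, ∑ b, θ a * η b * (g a x * k b x * (𝐏).gibbsDensity L T x) := by
    funext x
    rw [comb_apply, comb_apply, Finset.sum_mul_sum, Finset.sum_mul]
    refine Finset.sum_congr rfl fun a _ => ?_
    rw [Finset.sum_mul]
    refine Finset.sum_congr rfl fun b _ => ?_
    ring
  rw [hpt, integral_finsetSum _ fun a _ => integrable_finsetSum _ fun b _ => (hI a b).const_mul _]
  refine Finset.sum_congr rfl fun a _ => ?_
  rw [integral_finsetSum _ fun b _ => (hI a b).const_mul _]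
  refine Finset.sum_congr rfl fun b _ => ?_
  exact integral_const_mul _ _

end Bilinear

/-- Registered helper sub-goal `helper_kuboCombPair` of stub `stub_kuboOnsager` (= `comb_pair` in stub form; line
`floating-probe-bypass-laplacian`, crux stmt-AtomisticToContinuum-11748). [folklore] -/
theorem helper_kuboCombPair : ∀ {L m : ℕ} (P : OscillatorChain) (B : Fin L → ℝ) (T σ c : ℝ) (θ : Fin m → ℝ) {g k : Fin m → PhaseSpace L → ℝ}, (∀ a, ContDiff ℝ 2 (g a)) → (∀ a x, σ * liouvilleOp P L (g a) x + c * bathOp L B T (g a) x = -k a x) → ∀ (x : PhaseSpace L), σ * liouvilleOp P L (comb θ g) x + c * bathOp L B T (comb θ g) x = -comb θ k x :=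
  @comb_pair

end Summit.AtomisticToContinuum.FouriersLaw.Theorems.SuperadditiveResistance.Kubo

end
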